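import Summits.QuantumFields.YangMills.Theorems.BalabanUVNodesN15KingModelTranslationCovariancePermutations

/-!
# BalabanUVNodes ∕ N15 — THE KING-MODEL RUNG (PART Ϙ-h): AXIS RELABELLING WITH DERIVATIVE KINDS — `∂^η_μG^η_K(x∘π, y∘π) = ∂^η_{πμ}G^η_K(x, y)`,
# `∂^η_μℋ_K(x∘π, b∘π) = ∂^η_{πμ}ℋ_K(x, b)`, AND THE CONTINUUM TWO-POINT KERNEL OF A DIAGRAM WITH ARBITRARY LINE∕LEG KINDS AT RELABELLED SITES IS THE KERNEL OF
# THE DIAGRAM WITH RELABELLED KINDS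
# (Track A, DAG node N15 = NE2; FAN-OUT v1.1 §N15 s3 «KING-MODEL RUNG … NE2's analogue DECIDED in the model»)

HONEST FRAMING.  Count-neutral (cell `pub-ymgap`, seat `pub-ymgap-dag-n15-e` g31; `--supports stmt-QuantumFields-27366 --as helper` = K3⁸
`SpineGivenEndpointR13SepCoPHV`).  TEMPLATE LITERATURE: C. King, *The U(1) Higgs model. I. The continuum limit*, Commun. Math. Phys. **102** (1986) 649–677
[King1986] — KING's OWN `A = 0` MODEL on cubic tori.  NOT Bałaban's `G(U)`; NOT a node discharge (N15 is booked through n15-a's knit, untouched here); nothing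
continuum ∕ ℝ⁴ ∕ OS ∕ mass-gap ∕ Clay.  0 `sorry`; standard axioms; 0 `def`.  Sequel of part Ϙ-g (`…TranslationCovariancePermutations`: `torPerm`, the `G`-line ∕
`ℋ`-leg statements), which excluded derivative kinds; this file supplies them: under the relabelling `x ↦ x∘π` a forward difference in direction `μ` becomes the
forward difference in direction `πμ`, so King's derivative lines `∂^η_μG^η_K` (p. 663) and derivative legs `∂^η_μℋ_K` (Prop. 3.8 (3.71), second line) are
covariant with RELABELLED kinds `μ ↦ πμ` (`Option.map π`).

WHAT THIS FILE PROVES (kernel).  §1 (generic) ★ `graphValLS_equiv₂` (two line∕leg assignments `G′, u′` and `G, u` with `G′_ℓ(ex, ey) = G_ℓ(x, y)`, `u′_υ(ex) = u_υ(x)`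
give equal diagrams), `torPerm_fine_add_unitVec` (`x∘π + e_μ = (x + e_{πμ})∘π` on the fine torus).  §2 (cubic tori `Π_μ ℤ∕n`): `kingH_perm'`, ★ `dkingH_perm`
(`∂^η_μℋ_K(x∘π, b∘π) = ∂^η_{πμ}ℋ_K(x, b)`), ★ `kingGLine_perm` (ALL kinds: `kingGLine κ (x∘π) (y∘π) = kingGLine (κ.map π) x y`).  §3 (rung): `kingGLine_perm_rung`,
`kingExtLo_perm` (all leg kinds).  §4 (diagrams): ★★ `king_graph_legsLo_perm_kinds`, ★★ `kingPairSeq_perm_kinds`, ★★★ **`kingPairLim_perm_kinds`**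
(`E^{(∞)}(G, κ; κ₀, κ₁; b∘π, b′∘π) = E^{(∞)}(G, π∘κ; πκ₀, πκ₁; b, b′)` — the continuum two-point kernel of ANY numbered graph with derivative lines∕legs at relabelled
sites is the kernel of the graph with relabelled kinds; for `G`-lines∕`ℋ`-legs it is part Ϙ-g's invariance).  §5 (package) ★★ `kingPairLim_eq_kernel` (`E^{(∞)}(G; b, b′) =
k(b′ − b)`, `k(v) := E^{(∞)}(G; 0, v)`, any kinds), ★★★ **`kingPairLim_kernel_hyperoctahedral`** (`k(σ̇_κv) = k(v)` and `k(v∘π) = k(v)` for `G`-lines∕`ℋ`-legs: parts Ϙ-d∕Ϙ-f∕Ϙ-g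
in one statement).

HONEST SCOPE.  Cubic tori; identities only; reflections with derivative kinds (a reflected forward difference is minus a BACKWARD difference, not a line kind of the
rung) are not typed.  N15 untouched; counts unmoved.
Locators: [King1986] (2.13)–(2.15) p.653, p.663 («… or one of their derivatives»), Prop. 3.6 (3.56) p.662, Prop. 3.8 (3.71) p.664, (4.1)–(4.5) p.670.
-/

noncomputable section

open scoped BigOperators
open Finset Matrix Filter

/-! ## §1 Generic: two kernel assignments; the fine-torus unit vectors under the relabelling -/

namespace Summit.QuantumFields.YangMills.BalabanUVNodes.N15KingModelRung.Graph

section Equiv₂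

variable {V Λ Υ T : Type*} [Fintype V] [DecidableEq V] [Fintype Λ] [Fintype Υ] [Fintype T] {𝕂 : Type*} [CommSemiring 𝕂]

/-- ★ **TWO DIAGRAMS WHOSE LINE AND LEG KERNELS CORRESPOND UNDER A BIJECTION OF THE SITES ARE EQUAL**: `G′_ℓ(ex, ey) = G_ℓ(x, y)` and `u′_υ(ex) = u_υ(x)` give
`E(G′; u′) = E(G; u)` (re-index `σ ↦ e∘σ`). [cite: King1986, (3.55)–(3.59) pp.662–663] -/
theorem graphValLS_equiv₂ (e : T ≃ T) (w : 𝕂) (src tgt : Λ → V) (G G' : Λ → T → T → 𝕂) (vtx : Υ → V) (u u' : Υ → T → 𝕂)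
    (hG : ∀ ℓ x y, G' ℓ (e x) (e y) = G ℓ x y) (hu : ∀ υ x, u' υ (e x) = u υ x) :
    graphValLS w src tgt G' vtx u' = graphValLS w src tgt G vtx u := by
  unfold graphValLS
  calc ∑ σ : V → T, w ^ Fintype.card V * ((∏ ℓ, G' ℓ (σ (src ℓ)) (σ (tgt ℓ))) * ∏ υ, u' υ (σ (vtx υ)))
      = ∑ σ : V → T, w ^ Fintype.card V
          * ((∏ ℓ, G' ℓ ((Equiv.piCongrRight (fun _ : V => e) σ) (src ℓ)) ((Equiv.piCongrRight (fun _ : V => e) σ) (tgt ℓ)))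
            * ∏ υ, u' υ ((Equiv.piCongrRight (fun _ : V => e) σ) (vtx υ))) :=
        (Fintype.sum_equiv (Equiv.piCongrRight fun _ : V => e) _ _ fun _ => rfl).symm
    _ = ∑ σ : V → T, w ^ Fintype.card V * ((∏ ℓ, G ℓ (σ (src ℓ)) (σ (tgt ℓ))) * ∏ υ, u υ (σ (vtx υ))) :=
        Finset.sum_congr rfl fun σ _ => by simp only [Equiv.piCongrRight_apply, Pi.map_apply, hG, hu]

end Equiv₂

end Summit.QuantumFields.YangMills.BalabanUVNodes.N15KingModelRung.Graph

namespace Summit.QuantumFields.YangMills.BalabanUVNodes.N15KingModelRung.Perm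

open Literature.MathematicalPhysics.QuantumFieldTheory.Balaban1983to89.B5Prop11Plancherel (Tor fine unitVec)
open Literature.MathematicalPhysics.QuantumFieldTheory.King1986 (aK)
open Literature.MathematicalPhysics.QuantumFieldTheory.King1986.Torus
open Summit.QuantumFields.YangMills.BalabanUVNodes.N15KingModelRung
open Summit.QuantumFields.YangMills.BalabanUVNodes.N15KingModelRung.Curved (kingGLine)

variable {d : ℕ}

section Fine

variable (n : ℕ) [NeZero n] (π : Equiv.Perm (Fin (d + 1))) (N : ℕ) [NeZero N]

omit [NeZero n] [NeZero N] in
/-- `x∘π + e_μ = (x + e_{πμ})∘π` on the fine torus (read on the `N`-block spelling of its sites). [folklore] -/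
theorem torPerm_fine_add_unitVec (x : Tor (fine N (fun _ : Fin (d + 1) => n))) (μ : Fin (d + 1))
    {y : Tor (fine N (fun _ : Fin (d + 1) => n))} (hy : y = torPerm (N * n) π x) :
    y + unitVec (fine N (fun _ : Fin (d + 1) => n)) μ = torPerm (N * n) π (x + unitVec (fine N (fun _ : Fin (d + 1) => n)) (π μ)) := by
  subst hy
  funext ν
  show x (π ν) + unitVec (fine N (fun _ : Fin (d + 1) => n)) μ ν = x (π ν) + unitVec (fine N (fun _ : Fin (d + 1) => n)) (π μ) (π ν)
  unfold unitVec
  by_cases h : ν = μ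
  · subst h; simp only [Pi.single_eq_same]
  · rw [Pi.single_eq_of_ne h, Pi.single_eq_of_ne (fun h' => h (π.injective h'))]

variable (L : ℕ) [NeZero L]

omit [NeZero L] in
/-- `ℋ_k(x∘π, b∘π) = ℋ_k(x, b)` on the cubic torus (part Ϙ-g `minimiser_single_perm`, in the rung's `kingH` spelling). [cite: King1986, (2.15) p.653] -/
theorem kingH_perm' (a m2 : ℝ) (k : ℕ) (b : Tor (fun _ : Fin (d + 1) => n)) (x : Tor (fine N (fun _ : Fin (d + 1) => n))) :
    kingH L N (fun _ : Fin (d + 1) => n) a m2 k (torPerm n π b) (torPerm (N * n) π x) = kingH L N (fun _ : Fin (d + 1) => n) a m2 k b x :=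
  minimiser_single_perm n π N _ _ _ x b

omit [NeZero L] in
/-- ★ **`∂^η_μℋ_k(x∘π, b∘π) = ∂^η_{πμ}ℋ_k(x, b)`** — the derivative leg relabels its direction. [cite: King1986, Prop. 3.8 (3.71) p.664 (second line)] -/
theorem dkingH_perm (a m2 : ℝ) (k : ℕ) (b : Tor (fun _ : Fin (d + 1) => n)) (μ : Fin (d + 1)) (x : Tor (fine N (fun _ : Fin (d + 1) => n))) :
    dkingH L N (fun _ : Fin (d + 1) => n) a m2 k (torPerm n π b) μ (torPerm (N * n) π x) = dkingH L N (fun _ : Fin (d + 1) => n) a m2 k b (π μ) x := by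
  unfold dkingH
  rw [torPerm_fine_add_unitVec n π N x μ rfl, kingH_perm', kingH_perm']

/-- ★ **ALL LINE KINDS RELABEL**: `kingGLine κ (x∘π) (y∘π) = kingGLine (κ.map π) x y` — `G^η_k` invariant, `∂^η_μG^η_k ↦ ∂^η_{πμ}G^η_k`.
[cite: King1986, (2.13) p.653, p.663 («Every internal line … carries a propagator G_k … or one of their derivatives»)] -/
theorem kingGLine_perm (a msq : ℝ) (k : ℕ) (κ : Option (Fin (d + 1))) (x y : Tor (fine (L ^ k) (fun _ : Fin (d + 1) => n))) :
    kingGLine L (fun _ : Fin (d + 1) => n) a msq k κ (torPerm (L ^ k * n) π x) (torPerm (L ^ k * n) π y)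
      = kingGLine L (fun _ : Fin (d + 1) => n) a msq k (κ.map π) x y := by
  cases κ with
  | none => exact constrainedProp_perm n π (L ^ k) _ _ _ x y
  | some μ =>
      show (L : ℝ) ^ k * (constrainedProp (L ^ k) (fun _ : Fin (d + 1) => n) (aK a L k) (((L ^ k : ℕ) : ℝ) ^ 2) msq
              (torPerm (L ^ k * n) π x + unitVec (fine (L ^ k) (fun _ : Fin (d + 1) => n)) μ) (torPerm (L ^ k * n) π y)
            - constrainedProp (L ^ k) (fun _ : Fin (d + 1) => n) (aK a L k) (((L ^ k : ℕ) : ℝ) ^ 2) msq (torPerm (L ^ k * n) π x) (torPerm (L ^ k * n) π y))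
        = (L : ℝ) ^ k * (constrainedProp (L ^ k) (fun _ : Fin (d + 1) => n) (aK a L k) (((L ^ k : ℕ) : ℝ) ^ 2) msq
              (x + unitVec (fine (L ^ k) (fun _ : Fin (d + 1) => n)) (π μ)) y
            - constrainedProp (L ^ k) (fun _ : Fin (d + 1) => n) (aK a L k) (((L ^ k : ℕ) : ℝ) ^ 2) msq x y)
      rw [torPerm_fine_add_unitVec n π (L ^ k) x μ rfl, constrainedProp_perm, constrainedProp_perm]

end Fine

end Summit.QuantumFields.YangMills.BalabanUVNodes.N15KingModelRung.Perm

namespace Summit.QuantumFields.YangMills.BalabanUVNodes.N15KingModelRung.Curved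

open Literature.MathematicalPhysics.QuantumFieldTheory.Balaban1983to89.B5Prop11Plancherel (Tor fine)
open Literature.MathematicalPhysics.QuantumFieldTheory.King1986.Torus
open Summit.QuantumFields.YangMills.BalabanUVNodes.N15KingModelRung
open Summit.QuantumFields.YangMills.BalabanUVNodes.N15KingModelRung.Graph
open Summit.QuantumFields.YangMills.BalabanUVNodes.N15KingModelRung.Perm

variable {d : ℕ} (L : ℕ) [NeZero L] (π : Equiv.Perm (Fin (d + 1)))

/-! ## §3 The rung's lines and legs, all kinds -/

section Rung

/-- `kingGLine κ (x∘π) (y∘π) = kingGLine (κ.map π) x y` on the rung's torus. [cite: King1986, (2.13) p.653, p.663] -/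
theorem kingGLine_perm_rung (a msq : ℝ) (jv : KingVolIndex d) (κ : Option (Fin (d + 1)))
    (x y : haveI := kingVol_neZero L jv; Tor (fine (L ^ jv.K) (kingVol L jv))) :
    haveI := kingVol_neZero L jv
    kingGLine L (kingVol L jv) a msq jv.K κ (torPerm (L ^ jv.K * (2 * L ^ jv.m)) π x) (torPerm (L ^ jv.K * (2 * L ^ jv.m)) π y)
      = kingGLine L (kingVol L jv) a msq jv.K (κ.map π) x y := by
  haveI := kingVol_neZero L jv
  haveI : NeZero (2 * L ^ jv.m) := ⟨NeZero.ne (kingVol L jv 0)⟩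
  exact kingGLine_perm (2 * L ^ jv.m) π L a msq jv.K κ x y

/-- **ALL LEG KINDS RELABEL**: `kingExtLo (b∘π) κ (x∘π) = kingExtLo b (κ.map π) x`. [cite: King1986, Prop. 3.8 (3.71) p.664] -/
theorem kingExtLo_perm (a msq : ℝ) (jv : KingVolIndex d) (b : Tor (kingVol L jv)) (κ : Option (Fin (d + 1)))
    (x : haveI := kingVol_neZero L jv; Tor (fine (L ^ jv.K) (kingVol L jv))) :
    haveI := kingVol_neZero L jv
    kingExtLo L a msq jv (torPerm (2 * L ^ jv.m) π b) κ (torPerm (L ^ jv.K * (2 * L ^ jv.m)) π x) = kingExtLo L a msq jv b (κ.map π) x := by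
  haveI := kingVol_neZero L jv
  haveI : NeZero (2 * L ^ jv.m) := ⟨NeZero.ne (kingVol L jv 0)⟩
  cases κ with
  | none => exact kingH_perm' (2 * L ^ jv.m) π (L ^ jv.K) L a msq jv.K b x
  | some μ => exact dkingH_perm (2 * L ^ jv.m) π (L ^ jv.K) L a msq jv.K b μ x

end Rung

/-! ## §4 Diagrams with arbitrary kinds; the continuum two-point kernel -/

section Graphs

variable (a msq : ℝ) {nn m : ℕ} (src tgt : Fin m → Fin (nn + 1)) (κ : Fin m → Option (Fin (d + 1)))

/-- ★★ **RELABELLING THE AXES OF EVERY LEG SITE = RELABELLING EVERY KIND**: for any numbered graph (kinds `κ`), any legs (kinds `κe`),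
`E(G, κ; {b_υ∘π}, κe) = E(G, π∘κ; {b_υ}, π∘κe)`. [cite: King1986, Prop. 3.6 (3.56) p.662, Prop. 3.8 (3.71) p.664, (4.4) p.670] -/
theorem king_graph_legsLo_perm_kinds (jv : KingVolIndex d) (w : ℝ) {Υ : Type*} [Fintype Υ] (vtx : Υ → Fin (nn + 1)) (b : Υ → Tor (kingVol L jv))
    (κe : Υ → Option (Fin (d + 1))) :
    haveI := kingVol_neZero L jv
    graphValLS w src tgt (fun ℓ => kingGLine L (kingVol L jv) a msq jv.K (κ ℓ)) vtx
        (fun υ => kingExtLo L a msq jv (torPerm (2 * L ^ jv.m) π (b υ)) (κe υ))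
      = graphValLS w src tgt (fun ℓ => kingGLine L (kingVol L jv) a msq jv.K ((κ ℓ).map π)) vtx
        (fun υ => kingExtLo L a msq jv (b υ) ((κe υ).map π)) := by
  haveI := kingVol_neZero L jv
  exact graphValLS_equiv₂ (torPerm (L ^ jv.K * (2 * L ^ jv.m)) π) _ _ _ _ _ _ _ _
    (fun ℓ x y => kingGLine_perm_rung L π a msq jv (κ ℓ) x y) (fun υ x => kingExtLo_perm L π a msq jv (b υ) (κe υ) x)

/-- ★★ **THE TWO-POINT KERNEL ALONG `K`, ALL KINDS**: `E^{(K+1)}(G, κ; κ₀, κ₁; y_{b∘π}, y_{b′∘π}) = E^{(K+1)}(G, π∘κ; πκ₀, πκ₁; y_b, y_{b′})`.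
[cite: King1986, Prop. 3.6 (3.56) p.662, (4.1)–(4.5) p.670] -/
theorem kingPairSeq_perm_kinds (eM : ℕ) (v₁ : Fin (nn + 1)) (κ₀ κ₁ : Option (Fin (d + 1))) (b b' : Tor (kingVol L (jvSucc (d := d) eM 0))) (K : ℕ) :
    kingPairSeq L a msq eM nn m src tgt κ v₁ κ₀ κ₁ (torPerm (2 * L ^ eM) π b) (torPerm (2 * L ^ eM) π b') K
      = kingPairSeq L a msq eM nn m src tgt (fun ℓ => (κ ℓ).map π) v₁ (κ₀.map π) (κ₁.map π) b b' K := by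
  unfold kingPairSeq
  have hlegs : (fun υ => kingExtLo L a msq (jvSucc (d := d) eM K)
        ((![torPerm (2 * L ^ eM) π b, torPerm (2 * L ^ eM) π b'] : Fin 2 → Tor (kingVol L (jvSucc (d := d) eM 0))) υ) (![κ₀, κ₁] υ))
      = fun υ => kingExtLo L a msq (jvSucc (d := d) eM K) (torPerm (2 * L ^ (jvSucc (d := d) eM K).m) π (![b, b'] υ)) (![κ₀, κ₁] υ) := by
    funext υ; fin_cases υ <;> rfl
  have hlegs' : (fun υ => kingExtLo L a msq (jvSucc (d := d) eM K) (![b, b'] υ) (![κ₀.map π, κ₁.map π] υ))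
      = fun υ => kingExtLo L a msq (jvSucc (d := d) eM K) (![b, b'] υ) ((![κ₀, κ₁] υ).map π) := by
    funext υ; fin_cases υ <;> rfl
  rw [hlegs, hlegs']
  exact king_graph_legsLo_perm_kinds L π a msq src tgt κ (jvSucc (d := d) eM K) _ ![(0 : Fin (nn + 1)), v₁] ![b, b'] ![κ₀, κ₁]

/-- ★★★ **THE CONTINUUM TWO-POINT KERNEL AT RELABELLED SITES IS THE KERNEL WITH RELABELLED KINDS**: `E^{(∞)}(G, κ; κ₀, κ₁; b∘π, b′∘π) =
E^{(∞)}(G, π∘κ; πκ₀, πκ₁; b, b′)` (no convergence hypothesis). [cite: King1986, Thm 2.1 (i) (2.22) p.654, (4.1)–(4.5) p.670] -/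
theorem kingPairLim_perm_kinds (eM : ℕ) (v₁ : Fin (nn + 1)) (κ₀ κ₁ : Option (Fin (d + 1))) (b b' : Tor (kingVol L (jvSucc (d := d) eM 0))) :
    kingPairLim L a msq eM nn m src tgt κ v₁ κ₀ κ₁ (torPerm (2 * L ^ eM) π b) (torPerm (2 * L ^ eM) π b')
      = kingPairLim L a msq eM nn m src tgt (fun ℓ => (κ ℓ).map π) v₁ (κ₀.map π) (κ₁.map π) b b' := by
  unfold kingPairLim
  rw [show kingPairSeq L a msq eM nn m src tgt κ v₁ κ₀ κ₁ (torPerm (2 * L ^ eM) π b) (torPerm (2 * L ^ eM) π b')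
      = kingPairSeq L a msq eM nn m src tgt (fun ℓ => (κ ℓ).map π) v₁ (κ₀.map π) (κ₁.map π) b b' from
    funext fun K => kingPairSeq_perm_kinds L π a msq src tgt κ eM v₁ κ₀ κ₁ b b' K]

end Graphs

/-! ## §5 Package: the continuum two-point kernel of a `G`-line diagram as ONE function of the separation, invariant under the hyperoctahedral group -/

section Package

open Summit.QuantumFields.YangMills.BalabanUVNodes.N15.TwoGrid (torNeg)

variable (a msq : ℝ) {nn m : ℕ} (src tgt : Fin m → Fin (nn + 1)) (κ : Fin m → Option (Fin (d + 1))) (eM : ℕ) (v₁ : Fin (nn + 1))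
  (κ₀ κ₁ : Option (Fin (d + 1)))

/-- ★★ **THE CONTINUUM TWO-POINT KERNEL IS A FUNCTION OF THE SEPARATION**: `E^{(∞)}(G; b, b′) = k(b′ − b)` with `k(v) := E^{(∞)}(G; 0, v)` (part Ϙ-d's translation
invariance at `v := −b`; any kinds). [cite: King1986, Thm 2.1 (i) (2.22) p.654, Lemma 4.5 (4.38) p.674, (4.1)–(4.5) p.670] -/
theorem kingPairLim_eq_kernel (b b' : Tor (kingVol L (jvSucc (d := d) eM 0))) :
    kingPairLim L a msq eM nn m src tgt κ v₁ κ₀ κ₁ b b' = kingPairLim L a msq eM nn m src tgt κ v₁ κ₀ κ₁ 0 (b' - b) := by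
  have h := kingPairLim_transl L a msq eM src tgt κ v₁ κ₀ κ₁ b b' (-b)
  rw [add_neg_cancel, ← sub_eq_add_neg] at h
  exact h.symm

/-- ★★★ **THE KERNEL `k(v) = E^{(∞)}(G; 0, v)` OF A `G`-LINE DIAGRAM WITH `ℋ`-LEGS IS INVARIANT UNDER THE HYPEROCTAHEDRAL GROUP OF THE CUBIC LATTICE**: even in every
coordinate (part Ϙ-f) and symmetric under every axis relabelling (part Ϙ-g) — `k(σ̇_κv) = k(v)` and `k(v∘π) = k(v)`. [cite: King1986, Thm 2.1 (i) (2.22) p.654, (4.1)–(4.5) p.670] -/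
theorem kingPairLim_kernel_hyperoctahedral (κr : Fin (d + 1)) (v w : Tor (kingVol L (jvSucc (d := d) eM 0))) (hw : ∀ ν, w ν = v (π ν)) :
    kingPairLim L a msq eM nn m src tgt (fun _ => none) v₁ none none 0 (torNeg (kingVol L (jvSucc (d := d) eM 0)) κr v)
        = kingPairLim L a msq eM nn m src tgt (fun _ => none) v₁ none none 0 v
      ∧ kingPairLim L a msq eM nn m src tgt (fun _ => none) v₁ none none 0 w
        = kingPairLim L a msq eM nn m src tgt (fun _ => none) v₁ none none 0 v := by
  constructor
  · have h := kingPairLim_even L κr a msq src tgt eM v₁ 0 v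
    rwa [zero_add, zero_add] at h
  · have h := kingPairLim_perm_sep L π a msq src tgt eM v₁ 0 v w hw
    rwa [zero_add, zero_add] at h

end Package

end Summit.QuantumFields.YangMills.BalabanUVNodes.N15KingModelRung.Curved

end
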